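import Summits.CriticalPhenomena.PercolationContinuityZ3.Theorems.PercNearOneGluingNoHeavyLowerTailSahiTwoChainWRCoefficients
import Summits.CriticalPhenomena.PercolationContinuityZ3.Theorems.PercNearOneGluingNoHeavyLowerTailSahiBiChainPullback
import HarnessLib

/-!
# TCP pulled back: `E_n` of a family factoring through two independent chain statistics is a NONNEGATIVE COMBINATION of products
# of block probabilities (comb positivity of bichain families)

Support file of the one-cut programme (crux `NoHeavyLowerTail`, stmt-CriticalPhenomena-4575; cell `prim-masterthm`, seat P3, gen 16;
`run/shared/lean/prim/prim-masterthm/prim-masterthm-p3/HIERARCHY.md` §24; memo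
`run/shared/lean/prim/prim-masterthm/FROM-prim-masterthm-p3-g16-TWO-CHAIN-COEFFICIENTS.md` §3(iii)).

P2 (gen 15, `…SahiBiChainPullback`) pulled Lieb–Sahi's two-chain theorem back along a block map: for finite types `X₁, X₂` with probability
weights `w₁, w₂`, ANY maps `ℓ₁ : X₁ → α`, `ℓ₂ : X₂ → β` into finite chains and nonnegative monotone `f_i` on `α × β`,
`E_n^{w₁⊗w₂}(f ∘ (ℓ₁ × ℓ₂)) ≥ 0` (VALUES).  With the coefficientwise theorem of `…SahiTwoChainWRCoefficients` the same pull-back gives the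
COEFFICIENT statement:
* **`sahiE_comp_prodMap_eq_sum_et`** — `E_n^{w₁⊗w₂}(f ∘ (ℓ₁ × ℓ₂)) = Σ_{r,c} (Π_a w₁(ℓ₁ = r_a)) (Π_b w₂(ℓ₂ = c_b)) · κ(r,c)` with the universal
  coefficients `κ(r,c) = Ẽ_n^{[n]²}(f ∘ (r × c))` (any functions, any finite types; `w₁(ℓ₁ = l)` = the push-forward mass `pushWeight w₁ ℓ₁ l`);
* every `κ(r,c) ≥ 0` when `α, β` are chains and the `f_i` are nonnegative monotone — this is `et_coef_nonneg` of `…SahiTwoChainWRCoefficients`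
  (used in `sahiE_comp_prodMap_nonneg'`).
READING for the comb hierarchy ((M⁺-k), `…SahiCombMasterFamily`): when `X₁, X₂` are two disjoint blocks of independent coins, each block
probability `w₁(ℓ₁ = l)` is a nonnegative combination of degree-one tensor-Bernstein monomials of the block's biases, so the display exhibits
`p ↦ E_n(μ_p; f ∘ (ℓ₁ × ℓ₂))` as a nonnegative combination of tensor-Bernstein monomials of multidegree `n`: **bichain families (in particular all
families of two-block staircase functions `∨_r x_1⋯x_{a_r}·x'_1⋯x'_{b_r}`) are comb-positive at EVERY order** — a two-dimensional class, transversal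
to cores / chains / cylinders / juntas (HIERARCHY §9–§19).  The `CombPos` packaging is routine and left to the consumer files.
HONEST FRAMING: nothing here asserts (M⁺-k) or `C_k` in general.  Everything PROVED, standard axioms; no new definitions. [this work]
-/

noncomputable section

open scoped Classical

namespace Summit.CriticalPhenomena.PercolationContinuityZ3.Theorems

open Finset Function
open Literature.Combinatorics.Sahi2008

namespace SahiTwoChain

variable {X₁ X₂ α β : Type*} [Fintype X₁] [Fintype X₂] [Fintype α] [Fintype β]

/-- **TCP pulled back along a block map (the identity).**  For probability weights `w₁, w₂` on finite types, any maps `ℓ₁, ℓ₂` into finite types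
`α, β` and any `f_0,…,f_{n−1}` on `α × β`:
`E_n^{w₁⊗w₂}(f ∘ (ℓ₁ × ℓ₂)) = Σ_{r : Fin n → α} Σ_{c : Fin n → β} (Π_a (ℓ₁)_* w₁ (r a)) (Π_b (ℓ₂)_* w₂ (c b)) · Ẽ_n^{Fin n × Fin n}((a,b) ↦ f_i(r a, c b))`.
[this work] -/
theorem sahiE_comp_prodMap_eq_sum_et (w₁ : X₁ → ℝ) (w₂ : X₂ → ℝ) (h₁1 : ∑ x, w₁ x = 1) (h₂1 : ∑ y, w₂ y = 1)
    (ℓ₁ : X₁ → α) (ℓ₂ : X₂ → β) (n : ℕ) (f : Fin n → α × β → ℝ) :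
    sahiE (fun p : X₁ × X₂ => w₁ p.1 * w₂ p.2) n (fun i => f i ∘ Prod.map ℓ₁ ℓ₂) =
      ∑ r : Fin n → α, ∑ c : Fin n → β, ((∏ j, pushWeight w₁ ℓ₁ (r j)) * ∏ j, pushWeight w₂ ℓ₂ (c j)) *
        et (univ : Finset (Fin n)) (univ : Finset (Fin n)) n (fun i (p : Fin n × Fin n) => f i (r p.1, c p.2)) := by
  rw [← sahiE_pushWeight]
  have hpush : pushWeight (fun p : X₁ × X₂ => w₁ p.1 * w₂ p.2) (Prod.map ℓ₁ ℓ₂) =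
      fun c : α × β => pushWeight w₁ ℓ₁ c.1 * pushWeight w₂ ℓ₂ c.2 :=
    funext fun c => SahiBiChainPullback.pushWeight_prodMap w₁ w₂ ℓ₁ ℓ₂ c
  rw [hpush]
  refine sahiE_prodWeight_eq_sum_et (pushWeight w₁ ℓ₁) (pushWeight w₂ ℓ₂) ?_ ?_ n f
  · rw [sum_pushWeight, h₁1]
  · rw [sum_pushWeight, h₂1]

/-- The block-probability monomials are nonnegative for nonnegative weights (so each term of `sahiE_comp_prodMap_eq_sum_et` is `≥ 0`, re-proving
P2's value statement `SahiBiChainPullback.sahiE_comp_prodMap_nonneg` coefficient by coefficient). [this work] -/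
theorem sahiE_comp_prodMap_nonneg' [LinearOrder α] [LinearOrder β] (w₁ : X₁ → ℝ) (w₂ : X₂ → ℝ) (h₁0 : ∀ x, 0 ≤ w₁ x)
    (h₁1 : ∑ x, w₁ x = 1) (h₂0 : ∀ y, 0 ≤ w₂ y) (h₂1 : ∑ y, w₂ y = 1) (ℓ₁ : X₁ → α) (ℓ₂ : X₂ → β) (n : ℕ)
    (f : Fin n → α × β → ℝ) (hf : ∀ i c, 0 ≤ f i c) (hmono : ∀ i, Monotone (f i)) :
    0 ≤ sahiE (fun p : X₁ × X₂ => w₁ p.1 * w₂ p.2) n (fun i => f i ∘ Prod.map ℓ₁ ℓ₂) := by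
  rw [sahiE_comp_prodMap_eq_sum_et w₁ w₂ h₁1 h₂1 ℓ₁ ℓ₂ n f]
  refine Finset.sum_nonneg fun r _ => Finset.sum_nonneg fun c _ => mul_nonneg (mul_nonneg ?_ ?_) ?_
  · exact Finset.prod_nonneg fun j _ => pushWeight_nonneg h₁0 ℓ₁ _
  · exact Finset.prod_nonneg fun j _ => pushWeight_nonneg h₂0 ℓ₂ _
  · exact et_coef_nonneg f hf hmono r c

end SahiTwoChain

end Summit.CriticalPhenomena.PercolationContinuityZ3.Theorems
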